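import Literature.Analysis.FluidPDE.TorusNSSobolevControlLifespan
import Literature.Analysis.FluidPDE.TorusLinearisedNSStreamwiseHarmonics
import Mathlib.Analysis.SpecialFunctions.ExpDeriv
import Mathlib.Analysis.SpecialFunctions.Pow.Real
import HarnessLib

/-!
# Barrier: AUTONOMOUS DECAY LAWS `Ṅ ≤ −F(N)` / `Ṅ ≥ −G(N)` for ALL Navier–Stokes solutions on `𝕋³`
# are tested on the exact Stokes-mode line `a·e^{−4π²ν|k|²t}·sin(2πk·x)A` — one-sided damping laws
# are at best LINEAR (rate `q·4π²ν`), decay-rate floors and datum-independent lower envelopes do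
# not exist (cell `ns-claims`, D-0090, witness family W4/W5 of COUNTERMODEL-INDEX §6 gap G1/G2)

Barrier catalogue entry for `NavierStokesRegularity` (D-0021), METHOD LEVEL, everything PROVED
(zero fact debt; the tree's exact shear-wave solutions
`Literature.Analysis.FluidPDE.Torus.isClassicalNSSolutionOn_shearWave` — Pizzocchero 2021 §6 (6.3),
(6.6) — and their single-mode Sobolev functionals
`Torus.tsum_rpow_mul_norm_sq_mFourierCoeff_realTrigPoly_singleton`, (6.7)).

THE LINE. For `k = l·e₂ ∈ ℤ³` (`l ≠ 0`), polarisation `e₁ ⊥ k` and amplitude `a > 0`, the field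
`u(t, x) = e^{−4π²νl²t} · sin(2πl x₂) · a e₁` with pressure `0` is a global classical zero-mean
solution of the unforced Navier–Stokes system on `𝕋³ = (ℝ/ℤ)³` for EVERY `ν` (its nonlinearity
vanishes identically). Along it, any functional `N` that is positively homogeneous of degree `q > 0`
(`N(c·w) = c^q N(w)`, `c > 0`: every norm, seminorm, squared Sobolev norm, enstrophy, palinstrophy …)
is the explicit exponential `N(u(t)) = (a e^{−4π²νl²t})^q N(wave_l)`, so
`d/dt N(u(t)) = −q·4π²νl² · N(u(t))`, while the amplitude `a` puts `N(u(t))` at ANY prescribed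
positive value at any prescribed time.

CONSEQUENCES (the barrier; `T3`/`E3` = unit 3-torus / `ℝ³`):
* `dampingLaw_le_linear` — if `Ṅ ≤ −F(N)` holds at every `t > 0` along every global classical
  zero-mean solution, then `F(x) ≤ q·4π²ν·x` for all `x > 0` (mode `l = 1`): NO SUPERLINEAR
  (Osgood-beating, `x log x`, `x^{1+ε}`, …) A-PRIORI DAMPING LAW — the energy law
  `d/dt‖u‖₂² = −2ν‖∇u‖₂² ≤ −8π²ν‖u‖₂²` shows the bound is attained for `N = ‖·‖₂²`, `q = 2`;
* `no_decayRate_floor` — NO law `Ṅ ≥ −G(N)` can hold along all solutions for ANY real function `G`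
  (modes `l → ∞` decay arbitrarily fast at the same value of `N`), `ν > 0`;
* `no_lower_envelope` — for no `t > 0` and `θ > 0` does `N(u(t)) ≥ θ·N(u(0))` hold along all
  solutions (integrated form of the previous item; claimed «energy cannot decay faster than
  `e^{−2αt}`» statements), `ν > 0`;
* `hsSq_*` — the three statements discharged for the concrete Fourier-side functionals
  `N_s(w) = Σ_m |m|^{2s} |ŵ(m)|²` (every real `s`; `s = 0, 1` are `‖w‖₂²`, `‖∇w‖₂²/4π²`), `q = 2`.

Adjudicated instances this entry generalises (D-0090 protocol; cite the locator, not the author):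
C87 `Literature.Claims.NS.Harbeck2025.Step_osgood` ((1.17) p.20: a universal `x log`-superlinear `H¹`
damping law — false lemma, kernel `…Theorems.Harbeck2025.not_Step_osgood`, ABC line), C07
`Literature.Claims.NS.GlimmPetrillo2026.Step_3` (a universal decay-rate floor — false lemma,
`…GlimmPetrillo2026.not_Step_3`), C05c `Literature.Claims.NS.Moschandreou2024.Step_1` (`∫‖Δu‖² = 0`
along all flows), and the W4/W5 rows of the cell's COUNTERMODEL-INDEX (parallel-shear / Beltrami
eigenmode witnesses: C55, C127, C54, C80, C83; C53, C106, C113). The dilation-scaling companion is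
`ScalingAudit` (exponents of homogeneous functionals under the NS scaling); this file is the
AMPLITUDE/EIGENVALUE audit on an amplitude-invariant line of exact solutions, which the full solution
class is not.

WHAT THIS IS NOT: not a claim about NS regularity or blow-up; not a claim about any author beyond the
typed locator.
-/

noncomputable section

open MeasureTheory Set Filter UnitAddTorus
open scoped InnerProductSpace

namespace Literature.Barriers.NavierStokesRegularity

namespace ExactModeLine

open Literature.Analysis.FunctionSpaces Literature.Analysis.FunctionSpaces.Torus
  Literature.Analysis.FluidPDE

/-- The unit 3-torus `(ℝ/ℤ)³`. [folklore] -/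
abbrev T3 : Type := UnitAddTorus (Fin 3)
/-- Velocity values `ℝ³`. [folklore] -/
abbrev E3 : Type := EuclideanSpace ℝ (Fin 3)

/-- The wave vector `k = l e₂` (coordinate index `1`). [cite: Pizzocchero2021, §6 (6.6)] -/
def modeFreq (l : ℤ) : Fin 3 → ℤ := Pi.single 1 l

/-- The polarisation `e₁` (coordinate index `0`), transversal to `k`. [cite: Pizzocchero2021, §6 (6.6)] -/
def pol : E3 := EuclideanSpace.single 0 1

/-- The Stokes/shear eigenmode `wave_l(x) = sin(2πl x₂) e₁`. [cite: Pizzocchero2021, §6 (6.6)] -/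
def wave (l : ℤ) : T3 → E3 := fun x => (mFourier (modeFreq l) x).im • pol

/-- Its decay rate `4π²ν|k|² = 4π²νl²` (written as in the tree's shear-wave theorem). [cite: Pizzocchero2021, §6 (6.3)] -/
def rate (ν : ℝ) (l : ℤ) : ℝ := ν * (4 * Real.pi ^ 2 * freqNormSq (modeFreq l))

/-- The exact solution line `u(t) = e^{−rate·t} · sin(2πk·x) · (a e₁)`, amplitude `a`. [cite: Pizzocchero2021, §6 (6.3), (6.6)] -/
def line (ν : ℝ) (l : ℤ) (a : ℝ) : ℝ → T3 → E3 :=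
  fun t x => Real.exp (-(rate ν l) * t) • (mFourier (modeFreq l) x).im • (a • pol)

/-- `|l e₂|² = l²`. [folklore] -/
private theorem freqNormSq_modeFreq (l : ℤ) : freqNormSq (modeFreq l) = (l : ℝ) ^ 2 := by
  unfold freqNormSq modeFreq
  simp [Pi.single_apply]

/-- `rate ν l = 4π²ν l²`. [folklore] -/
private theorem rate_eq (ν : ℝ) (l : ℤ) : rate ν l = 4 * Real.pi ^ 2 * ν * (l : ℝ) ^ 2 := by
  rw [rate, freqNormSq_modeFreq]; ring

/-- Transversality `k · (a e₁) = 0`. [folklore] -/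
private theorem transversal (l : ℤ) (a : ℝ) : ∑ j, ((modeFreq l j : ℤ) : ℝ) * (a • pol) j = 0 := by
  simp [modeFreq, pol, Pi.single_apply]

/-- **The line is an exact global classical solution with zero pressure, every `ν`, `l`, `a`**
(tree `Torus.isClassicalNSSolutionOn_shearWave`). [cite: Pizzocchero2021, §6 (6.3), (6.6)] -/
theorem isClassicalNSSolutionOn_line (ν : ℝ) (l : ℤ) (a : ℝ) :
    Torus.IsClassicalNSSolutionOn (Ici 0) ν 0 (line ν l a) (fun _ _ => 0) := by
  unfold line rate
  exact Torus.isClassicalNSSolutionOn_shearWave ν (transversal l a)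

/-- The time slices of the line are positive multiples of the fixed mode: `u(t) = (a e^{−rate t}) • wave_l`. [folklore] -/
private theorem line_slice (ν : ℝ) (l : ℤ) (a t : ℝ) :
    line ν l a t = (Real.exp (-(rate ν l) * t) * a) • wave l := by
  funext x
  simp only [line, wave, Pi.smul_apply]
  rw [smul_comm ((mFourier (modeFreq l) x).im) a pol, smul_smul]

/-- The initial slice written as a single real trigonometric mode (for the zero-mean lemma). [folklore] -/
private theorem line_zero_eq_realTrigPoly (ν : ℝ) (l : ℤ) (a : ℝ) :
    line ν l a 0 = realTrigPoly {modeFreq l} (fun _ => (-Complex.I) • EuclideanSpace.complexify (a • pol)) := by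
  funext x
  rw [Torus.realTrigPoly_singleton_neg_I_smul_complexify]
  simp [line]

/-- **The datum of the line has zero mean** (`l ≠ 0`). [folklore] -/
private theorem hasZeroMean_line_zero (ν : ℝ) {l : ℤ} (hl : l ≠ 0) (a : ℝ) :
    Torus.HasZeroMean (line ν l a 0) := by
  rw [line_zero_eq_realTrigPoly]
  exact Torus.hasZeroMean_realTrigPoly_single 1 hl _

variable {N : (T3 → E3) → ℝ} {q : ℝ}

/-- Along the line a degree-`q` homogeneous functional is the explicit exponential
`N(u(t)) = (e^{−rate t} a)^q · N(wave_l)` (`a > 0`; Pizzocchero: `‖v(t)‖_n = e^{−κ²νt}‖v₀‖_n`,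
`‖v₀‖_n = κ^n‖v₀‖_{L²}` arbitrarily large). [cite: Pizzocchero2021, §6 (6.3), (6.7)] -/
theorem N_line (hN : ∀ c : ℝ, 0 < c → ∀ w : T3 → E3, N (c • w) = c ^ q * N w)
    (ν : ℝ) (l : ℤ) {a : ℝ} (ha : 0 < a) (t : ℝ) :
    N (line ν l a t) = (Real.exp (-(rate ν l) * t) * a) ^ q * N (wave l) := by
  rw [line_slice]
  exact hN _ (mul_pos (Real.exp_pos _) ha) _

/-- The same value as `a^q N(wave_l) · e^{(−q·rate) t}`. [folklore] -/
private theorem N_line' (hN : ∀ c : ℝ, 0 < c → ∀ w : T3 → E3, N (c • w) = c ^ q * N w)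
    (ν : ℝ) (l : ℤ) {a : ℝ} (ha : 0 < a) (t : ℝ) :
    N (line ν l a t) = a ^ q * N (wave l) * Real.exp (-(q * rate ν l) * t) := by
  rw [N_line hN ν l ha t, Real.mul_rpow (Real.exp_pos _).le ha.le, ← Real.exp_mul]
  ring_nf

/-- **The time derivative along the line is LINEAR in `N`: `d/dt N(u(t)) = −q·rate·N(u(t))`**
(the decay law `v(t) = e^{−κ²νt}v₀` differentiated). [cite: Pizzocchero2021, §6 (6.3)] -/
theorem deriv_N_line (hN : ∀ c : ℝ, 0 < c → ∀ w : T3 → E3, N (c • w) = c ^ q * N w)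
    (ν : ℝ) (l : ℤ) {a : ℝ} (ha : 0 < a) (t : ℝ) :
    deriv (fun s => N (line ν l a s)) t = -(q * rate ν l) * N (line ν l a t) := by
  have hfun : (fun s => N (line ν l a s)) =
      fun s => a ^ q * N (wave l) * Real.exp (-(q * rate ν l) * s) := by
    funext s; exact N_line' hN ν l ha s
  rw [hfun, N_line' hN ν l ha t]
  have hd : HasDerivAt (fun s => a ^ q * N (wave l) * Real.exp (-(q * rate ν l) * s))
      (a ^ q * N (wave l) * (Real.exp (-(q * rate ν l) * t) * (-(q * rate ν l)))) t := by
    have h1 : HasDerivAt (fun s => -(q * rate ν l) * s) (-(q * rate ν l)) t := by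
      simpa using (hasDerivAt_id t).const_mul (-(q * rate ν l))
    exact h1.exp.const_mul _
  rw [hd.deriv]
  ring

/-- Amplitude hitting a prescribed value: with `a = e^{rate t}(x / N(wave_l))^{1/q}` one has
`N(u(t)) = x` (`x > 0`, `N(wave_l) > 0`, `q ≠ 0`). [folklore] -/
private theorem exists_amplitude (hN : ∀ c : ℝ, 0 < c → ∀ w : T3 → E3, N (c • w) = c ^ q * N w)
    (hq : q ≠ 0) (ν : ℝ) {l : ℤ} (hpos : 0 < N (wave l)) (t : ℝ) {x : ℝ} (hx : 0 < x) :
    ∃ a : ℝ, 0 < a ∧ N (line ν l a t) = x := by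
  set b : ℝ := (x / N (wave l)) ^ (1 / q) with hb
  have hb0 : 0 < b := Real.rpow_pos_of_pos (div_pos hx hpos) _
  refine ⟨Real.exp (rate ν l * t) * b, mul_pos (Real.exp_pos _) hb0, ?_⟩
  rw [N_line hN ν l (mul_pos (Real.exp_pos _) hb0) t]
  have hcollapse : Real.exp (-(rate ν l) * t) * (Real.exp (rate ν l * t) * b) = b := by
    rw [← mul_assoc, ← Real.exp_add]; simp
  rw [hcollapse, hb, ← Real.rpow_mul (div_pos hx hpos).le, one_div_mul_cancel hq, Real.rpow_one,
    div_mul_cancel₀ _ hpos.ne']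

/-! ## The barrier theorems (abstract functional `N`, degree `q > 0`) -/

/-- **NO SUPERLINEAR A-PRIORI DAMPING LAW.** If `d/dt N(u(t)) ≤ −F(N(u(t)))` at every `t > 0` along
every global classical zero-mean solution of the unforced Navier–Stokes system on `𝕋³`, then
`F(x) ≤ q·4π²ν·x` for every `x > 0` (mode `l = 1`, amplitude tuned so that `N(u(1)) = x`).
[cite: Pizzocchero2021, §6 (6.3), (6.6)–(6.7)] -/
theorem dampingLaw_le_linear (hq : 0 < q)
    (hN : ∀ c : ℝ, 0 < c → ∀ w : T3 → E3, N (c • w) = c ^ q * N w) (hpos : 0 < N (wave 1))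
    (ν : ℝ) {F : ℝ → ℝ}
    (hlaw : ∀ (u : ℝ → T3 → E3) (p : ℝ → T3 → ℝ), Torus.IsClassicalNSSolutionOn (Ici 0) ν 0 u p →
      Torus.HasZeroMean (u 0) → ∀ t : ℝ, 0 < t → deriv (fun s => N (u s)) t ≤ -F (N (u t))) :
    ∀ x : ℝ, 0 < x → F x ≤ q * (4 * Real.pi ^ 2 * ν) * x := by
  intro x hx
  obtain ⟨a, ha, hax⟩ := exists_amplitude hN hq.ne' ν (l := 1) hpos 1 hx
  have h := hlaw _ _ (isClassicalNSSolutionOn_line ν 1 a) (hasZeroMean_line_zero ν one_ne_zero a)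
    1 one_pos
  rw [deriv_N_line hN ν 1 ha 1, hax, rate_eq] at h
  push_cast at h
  nlinarith [h]

/-- **NO DECAY-RATE FLOOR.** For `ν > 0` no real function `G` satisfies `d/dt N(u(t)) ≥ −G(N(u(t)))`
at every `t > 0` along every global classical zero-mean solution: at the common value `N(u(1)) = 1`
the modes `l = 1, 2, 3, …` have derivative `−q·4π²νl²`, unbounded below.
[cite: Pizzocchero2021, §6 (6.3), (6.6)–(6.7)] -/
theorem no_decayRate_floor (hq : 0 < q)
    (hN : ∀ c : ℝ, 0 < c → ∀ w : T3 → E3, N (c • w) = c ^ q * N w)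
    (hpos : ∀ l : ℕ, 0 < l → 0 < N (wave l)) {ν : ℝ} (hν : 0 < ν) (G : ℝ → ℝ) :
    ¬ ∀ (u : ℝ → T3 → E3) (p : ℝ → T3 → ℝ), Torus.IsClassicalNSSolutionOn (Ici 0) ν 0 u p →
      Torus.HasZeroMean (u 0) → ∀ t : ℝ, 0 < t → -G (N (u t)) ≤ deriv (fun s => N (u s)) t := by
  intro hlaw
  -- a mode number `l ≥ 1` with `q·4π²ν·l > G 1` (then `q·4π²ν·l² ≥ q·4π²ν·l > G 1`)
  obtain ⟨n, hn⟩ := exists_nat_gt (G 1 / (q * (4 * Real.pi ^ 2 * ν)))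
  set l : ℕ := n + 1 with hl
  have hl0 : 0 < l := Nat.succ_pos n
  have hlz : ((l : ℕ) : ℤ) ≠ 0 := by exact_mod_cast hl0.ne'
  have hc : 0 < q * (4 * Real.pi ^ 2 * ν) := by positivity
  have hG : G 1 < (l : ℝ) * (q * (4 * Real.pi ^ 2 * ν)) := by
    have h1 : G 1 / (q * (4 * Real.pi ^ 2 * ν)) < (l : ℝ) := by
      have : (n : ℝ) < (l : ℝ) := by rw [hl]; push_cast; linarith
      linarith
    rwa [div_lt_iff₀ hc] at h1
  obtain ⟨a, ha, hax⟩ := exists_amplitude hN hq.ne' ν (l := (l : ℤ)) (hpos l hl0) 1 one_pos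
  have h := hlaw _ _ (isClassicalNSSolutionOn_line ν l a) (hasZeroMean_line_zero ν hlz a) 1 one_pos
  rw [deriv_N_line hN ν l ha 1, hax, rate_eq] at h
  push_cast at h
  have hl1 : (1 : ℝ) ≤ (l : ℝ) := by exact_mod_cast hl0
  have hsq : (l : ℝ) ≤ (l : ℝ) ^ 2 := by nlinarith
  have hmono : (l : ℝ) * (q * (4 * Real.pi ^ 2 * ν)) ≤ (l : ℝ) ^ 2 * (q * (4 * Real.pi ^ 2 * ν)) :=
    mul_le_mul_of_nonneg_right hsq hc.le
  linarith

/-- **NO DATUM-INDEPENDENT LOWER ENVELOPE.** For `ν > 0`, `t > 0`, `θ > 0` it is false that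
`N(u(t)) ≥ θ·N(u(0))` along every global classical zero-mean solution (mode `l` large:
`N(u(t))/N(u(0)) = e^{−q·4π²νl²t} < θ`). [cite: Pizzocchero2021, §6 (6.3), (6.6)–(6.7)] -/
theorem no_lower_envelope (hq : 0 < q)
    (hN : ∀ c : ℝ, 0 < c → ∀ w : T3 → E3, N (c • w) = c ^ q * N w)
    (hpos : ∀ l : ℕ, 0 < l → 0 < N (wave l)) {ν : ℝ} (hν : 0 < ν) {t θ : ℝ} (ht : 0 < t) (hθ : 0 < θ) :
    ¬ ∀ (u : ℝ → T3 → E3) (p : ℝ → T3 → ℝ), Torus.IsClassicalNSSolutionOn (Ici 0) ν 0 u p →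
      Torus.HasZeroMean (u 0) → θ * N (u 0) ≤ N (u t) := by
  intro hlaw
  -- choose `l ≥ 1` with `q·4π²ν·t·l > −log θ`, so that `e^{−q·4π²νl²t} < θ`
  obtain ⟨n, hn⟩ := exists_nat_gt (-Real.log θ / (q * (4 * Real.pi ^ 2 * ν) * t))
  set l : ℕ := n + 1 with hl
  have hl0 : 0 < l := Nat.succ_pos n
  have hlz : ((l : ℕ) : ℤ) ≠ 0 := by exact_mod_cast hl0.ne'
  have hc : 0 < q * (4 * Real.pi ^ 2 * ν) * t := by positivity
  have hlt : -Real.log θ < (l : ℝ) * (q * (4 * Real.pi ^ 2 * ν) * t) := by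
    have h1 : -Real.log θ / (q * (4 * Real.pi ^ 2 * ν) * t) < (l : ℝ) := by
      have : (n : ℝ) < (l : ℝ) := by rw [hl]; push_cast; linarith
      linarith
    rwa [div_lt_iff₀ hc] at h1
  have hl1 : (1 : ℝ) ≤ (l : ℝ) := by exact_mod_cast hl0
  have hsq : (l : ℝ) ≤ (l : ℝ) ^ 2 := by nlinarith
  have hmono : (l : ℝ) * (q * (4 * Real.pi ^ 2 * ν) * t) ≤ (l : ℝ) ^ 2 * (q * (4 * Real.pi ^ 2 * ν) * t) :=
    mul_le_mul_of_nonneg_right hsq hc.le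
  have hexp : Real.exp (-(q * rate ν l) * t) < θ := by
    rw [← Real.exp_log hθ, Real.exp_lt_exp, rate_eq]
    push_cast
    nlinarith [hmono, hlt]
  have h := hlaw _ _ (isClassicalNSSolutionOn_line ν l 1) (hasZeroMean_line_zero ν hlz 1)
  rw [N_line' hN ν l one_pos t, N_line' hN ν l one_pos 0] at h
  simp only [mul_zero, Real.exp_zero, mul_one, Real.one_rpow, one_mul] at h
  have hw := hpos l hl0
  nlinarith [mul_lt_mul_of_pos_left hexp hw]

/-! ## Concrete instance: the Fourier-side Sobolev functionals `N_s(w) = Σ_m |m|^{2s}|ŵ(m)|²` -/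

/-- `N_s(w) = Σ_m |m|^{2s} |ŵ(m)|²` (the tree's `Ḣ^s` functional squared; `s = 0`: `‖w‖₂²`,
`s = 1`: `‖∇w‖₂²/(4π²)`). [cite: Pizzocchero2021, §6 (6.2), (6.7)] -/
def hsSq (s : ℝ) (w : T3 → E3) : ℝ :=
  ∑' m : Fin 3 → ℤ, freqNormSq m ^ s * ‖mFourierCoeff (EuclideanSpace.complexify ∘ w) m‖ ^ 2

/-- Degree-2 homogeneity `N_s(c w) = c² N_s(w)`. [folklore] -/
private theorem hsSq_smul (s : ℝ) {c : ℝ} (hc : 0 < c) (w : T3 → E3) :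
    hsSq s (c • w) = c ^ (2 : ℝ) * hsSq s w := by
  have hfun : (⇑(EuclideanSpace.complexify (ι := Fin 3)) ∘ (c • w)) =
      (c : ℂ) • (⇑(EuclideanSpace.complexify (ι := Fin 3)) ∘ w) := by
    funext x
    simp only [Function.comp_apply, Pi.smul_apply, LinearIsometry.map_smul, Complex.coe_smul]
  have h : ∀ m : Fin 3 → ℤ, freqNormSq m ^ s *
      ‖mFourierCoeff (EuclideanSpace.complexify ∘ (c • w)) m‖ ^ 2 =
      c ^ 2 * (freqNormSq m ^ s * ‖mFourierCoeff (EuclideanSpace.complexify ∘ w) m‖ ^ 2) := by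
    intro m
    rw [hfun, mFourierCoeff_const_smul, norm_smul, Complex.norm_real, Real.norm_eq_abs,
      abs_of_pos hc]
    ring
  rw [Real.rpow_two]
  unfold hsSq
  simp_rw [h]
  rw [tsum_mul_left]

/-- The value on the mode: `N_s(wave_l) = (l²)^s / 2 > 0`. [cite: Pizzocchero2021, §6 (6.7)] -/
theorem hsSq_wave (s : ℝ) {l : ℤ} (hl : l ≠ 0) : hsSq s (wave l) = ((l : ℝ) ^ 2) ^ s / 2 := by
  have hk : modeFreq l ≠ 0 := fun h => hl (by simpa [modeFreq] using congrFun h 1)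
  have hw : wave l = realTrigPoly {modeFreq l} (fun _ => (-Complex.I) • EuclideanSpace.complexify pol) := by
    funext x; rw [Torus.realTrigPoly_singleton_neg_I_smul_complexify]; rfl
  unfold hsSq
  rw [hw, Torus.tsum_rpow_mul_norm_sq_mFourierCoeff_realTrigPoly_singleton hk, freqNormSq_modeFreq,
    norm_smul, norm_neg, Complex.norm_I, one_mul, EuclideanSpace.norm_complexify]
  simp [pol, div_eq_mul_inv]

/-- Positivity on every mode `l ≥ 1`. [folklore] -/
private theorem hsSq_wave_pos (s : ℝ) {l : ℕ} (hl : 0 < l) : 0 < hsSq s (wave l) := by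
  rw [hsSq_wave s (by exact_mod_cast hl.ne')]
  have : 0 < ((l : ℤ) : ℝ) ^ 2 := by positivity
  positivity

/-- **Instance (a): every a-priori damping law `d/dt N_s(u) ≤ −F(N_s(u))` for all solutions on `𝕋³`
has `F(x) ≤ 8π²ν x`.** [cite: Pizzocchero2021, §6 (6.3), (6.6)–(6.7)] -/
theorem hsSq_dampingLaw_le_linear (s ν : ℝ) {F : ℝ → ℝ}
    (hlaw : ∀ (u : ℝ → T3 → E3) (p : ℝ → T3 → ℝ), Torus.IsClassicalNSSolutionOn (Ici 0) ν 0 u p →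
      Torus.HasZeroMean (u 0) → ∀ t : ℝ, 0 < t → deriv (fun τ => hsSq s (u τ)) t ≤ -F (hsSq s (u t))) :
    ∀ x : ℝ, 0 < x → F x ≤ 8 * Real.pi ^ 2 * ν * x := by
  intro x hx
  have h := dampingLaw_le_linear (N := hsSq s) two_pos (fun _ hc w => hsSq_smul s hc w)
    (by exact_mod_cast hsSq_wave_pos s one_pos) ν hlaw x hx
  linarith

/-- **Instance (b): no decay-rate floor `d/dt N_s(u) ≥ −G(N_s(u))` for all solutions, any `G`
(`ν > 0`).** [cite: Pizzocchero2021, §6 (6.3), (6.6)–(6.7)] -/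
theorem hsSq_no_decayRate_floor (s : ℝ) {ν : ℝ} (hν : 0 < ν) (G : ℝ → ℝ) :
    ¬ ∀ (u : ℝ → T3 → E3) (p : ℝ → T3 → ℝ), Torus.IsClassicalNSSolutionOn (Ici 0) ν 0 u p →
      Torus.HasZeroMean (u 0) → ∀ t : ℝ, 0 < t → -G (hsSq s (u t)) ≤ deriv (fun τ => hsSq s (u τ)) t :=
  no_decayRate_floor (N := hsSq s) two_pos (fun _ hc w => hsSq_smul s hc w)
    (fun _ hl => hsSq_wave_pos s hl) hν G

/-- **Instance (c): no datum-independent lower envelope `N_s(u(t)) ≥ θ N_s(u(0))` for all solutions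
(`ν, t, θ > 0`).** [cite: Pizzocchero2021, §6 (6.3), (6.6)–(6.7)] -/
theorem hsSq_no_lower_envelope (s : ℝ) {ν t θ : ℝ} (hν : 0 < ν) (ht : 0 < t) (hθ : 0 < θ) :
    ¬ ∀ (u : ℝ → T3 → E3) (p : ℝ → T3 → ℝ), Torus.IsClassicalNSSolutionOn (Ici 0) ν 0 u p →
      Torus.HasZeroMean (u 0) → θ * hsSq s (u 0) ≤ hsSq s (u t) :=
  no_lower_envelope (N := hsSq s) two_pos (fun _ hc w => hsSq_smul s hc w)
    (fun _ hl => hsSq_wave_pos s hl) hν ht hθ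

end ExactModeLine

open ExactModeLine Literature.Analysis.FunctionSpaces Literature.Analysis.FluidPDE

/-- **Barrier (method-level lemma): autonomous decay laws for ALL Navier–Stokes solutions on `𝕋³`
die on the exact Stokes-mode line — damping laws are at best linear, floors and envelopes do not exist.**

BARRIER (structured block, D-0021):
technique_class: universal-superlinear-damping-law osgood-decay-a-priori decay-rate-floor energy-cannot-decay-faster lower-envelope-for-all-solutions autonomous-ode-for-norms amplitude-homogeneity-audit
blocks: arguments for NavierStokesRegularity (global regularity via an a-priori law `d/dt N ≤ −F(N)` with `F` superlinear — Osgood/`x log x`/`x^{1+ε}` damping of `‖u‖_{H¹}`, enstrophy, `Ḣ^s` — claimed for EVERY smooth solution; or blow-up/turbulence arguments via a universal decay-rate floor `d/dt N ≥ −G(N)` / lower envelope `N(t) ≥ θ(t)N(0)`): the decisive display is an autonomous one-sided comparison for a homogeneous functional along all solutions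
because: the shear/Stokes eigenmodes `a e^{−4π²ν|k|²t} sin(2πk·x)A` (`A ⊥ k`) are exact global classical zero-mean solutions for every amplitude `a` and wave number `k` [cite: Pizzocchero2021, §6 (6.3), (6.6)] (tree `Torus.isClassicalNSSolutionOn_shearWave`); along them every degree-`q` homogeneous `N` obeys the LINEAR law `Ṅ = −q·4π²ν|k|²·N` exactly while `a` places `N` at any value: `dampingLaw_le_linear` (`F(x) ≤ q·4π²ν x`), `no_decayRate_floor`, `no_lower_envelope`; discharged for `N_s = Σ|m|^{2s}|ŵ(m)|²` (`hsSq_*`, constant `8π²ν`)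
evasions_known: (a) laws with DATUM-DEPENDENT constants (`F = F_{u₀}`, e.g. Foias–Temam-type Gevrey/ladder bounds on a finite window) are not excluded — only universal `F`; (b) CONDITIONAL laws (under a Prodi–Serrin / small-data hypothesis) are not excluded; (c) laws for functionals that are NOT homogeneous (entropy-type `∫|u|² log|u|`) need the amplitude audit redone by hand; (d) the 2D / linear Stokes problem obeys the same ceiling — the barrier says nothing nonlinear, it only forbids claiming more than the linear rate universally
scope_caveats: (i) periodic zero-mean setting `𝕋³ = (ℝ/ℤ)³`, unforced; on `ℝ³` the analogous line is the Gaussian heat/Stokes flow (no spectral gap: even the linear law fails, cf. `TimeTaylorFiniteRadius` for the same Gaussian object); (ii) `deriv` at interior times `t > 0` — claims phrased with `HasDerivAt`/integrated inequalities imply this form; (iii) the positivity / homogeneity of `N` are hypotheses of the abstract theorems and are discharged here only for the Fourier-side functionals `hsSq s`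
status: established (proved here; zero fact debt)
[cite: Pizzocchero2021, §6 (6.3), (6.6)–(6.7)] -/
def ExactModeLineDecayLaws : Prop :=
  (∀ s ν : ℝ, ∀ F : ℝ → ℝ,
    (∀ (u : ℝ → T3 → E3) (p : ℝ → T3 → ℝ), Torus.IsClassicalNSSolutionOn (Ici 0) ν 0 u p →
      Torus.HasZeroMean (u 0) → ∀ t : ℝ, 0 < t → deriv (fun τ => hsSq s (u τ)) t ≤ -F (hsSq s (u t))) →
    ∀ x : ℝ, 0 < x → F x ≤ 8 * Real.pi ^ 2 * ν * x) ∧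
  (∀ s ν : ℝ, 0 < ν → ∀ G : ℝ → ℝ,
    ¬ ∀ (u : ℝ → T3 → E3) (p : ℝ → T3 → ℝ), Torus.IsClassicalNSSolutionOn (Ici 0) ν 0 u p →
      Torus.HasZeroMean (u 0) → ∀ t : ℝ, 0 < t → -G (hsSq s (u t)) ≤ deriv (fun τ => hsSq s (u τ)) t) ∧
  (∀ s ν t θ : ℝ, 0 < ν → 0 < t → 0 < θ →
    ¬ ∀ (u : ℝ → T3 → E3) (p : ℝ → T3 → ℝ), Torus.IsClassicalNSSolutionOn (Ici 0) ν 0 u p →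
      Torus.HasZeroMean (u 0) → θ * hsSq s (u 0) ≤ hsSq s (u t))

/-- Discharge of the barrier statement. [cite: Pizzocchero2021, §6 (6.3), (6.6)–(6.7)] -/
theorem exactModeLineDecayLaws_holds : ExactModeLineDecayLaws :=
  ⟨fun s ν _ hlaw => hsSq_dampingLaw_le_linear s ν hlaw,
    fun s _ hν G => hsSq_no_decayRate_floor s hν G,
    fun s _ _ _ hν ht hθ => hsSq_no_lower_envelope s hν ht hθ⟩

/-- `ExactModeLineDecayLaws` — `_holds` alias of `exactModeLineDecayLaws_holds` above under the fact's exact name (appended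
2026-08-28, D-0026 bookkeeping: the proof term is the existing theorem of this file; no statement,
definition or attribute is edited; no new named fact; the ledger's debt table listed the fact
unproved). [cite: Pizzocchero2021, §6 (6.3), (6.6)–(6.7)] -/
theorem _root_.Literature.Barriers.NavierStokesRegularity.ExactModeLineDecayLaws_holds :
    ExactModeLineDecayLaws :=
  _root_.Literature.Barriers.NavierStokesRegularity.exactModeLineDecayLaws_holds

end Literature.Barriers.NavierStokesRegularity

end

-- WHAT THIS IS NOT: not a claim about NS regularity or blow-up; not a claim about any author beyond the typed locator.
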